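import Summits.QuantumAdvantage.QuantumAdvantage.Theorems.LocusDialPointer

/-!
# LocusDialFreePointerAE — the A.E.-DECLARED free pointer `FreePointerLossAE3`

Cell decomp-qadv, seat lens-2, generation 17 — tree part (supports item stmt-QuantumAdvantage-27137
`Theses.StabilizerDial.FewLocusLoss3` = `Theorems.LocusDial.FewLocusLoss3`, piece `U`).

WHY: the leaf `FreePointerLoss3` (`LocusDialPointer`) asks for an EVERYWHERE-unique declaration, but the few-locus class
(`FewLocus`, and `MAnchorable` on the anchored side) is an A.E. notion with exceptional mass `≤ 2^{n-1}/log₂ n` — far above the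
target loss `n^{-C}` — so a reduction of `U`'s free strip to a pointer law can only ever produce A.E. declarations, and an
a.e.-declared low-degree family cannot in general be completed to an everywhere-declared one in low degree.  The honest
leaf is therefore the A.E. version **`FreePointerLossAE3`**: exceptional (non-uniquely-declared) mass `≤ 2^{n-1}/log₂ n` in
the hypothesis, and ONLY uniquely-declared inputs whose declared position is a kernel position counted as wins in the
conclusion (counting the exceptional inputs as wins would make the statement unprovable from `U`, their mass swamping `n^{-C}`).

PROVED: `freePointerLossAE3_of_fewLocusLoss3 : FewLocusLoss3 → FreePointerLossAE3` (necessity: `mpStrat A 1` is few-locus at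
`(1, 0)` with exceptional set inside the non-uniquely-declared inputs, and wins at every uniquely declared kernel position),
`freePointerLoss3_of_ae : FreePointerLossAE3 → FreePointerLoss3` (empty exceptional set), `freePointerLossAE3_of_polyLossOddU3`.
So `U → FreePointerLossAE3 → FreePointerLoss3 → AdaptiveAffinePointerLoss3 → AffinePointerLoss3` by name; whether
`FreePointerLoss3 → FreePointerLossAE3` holds is open (not needed).  For a skeleton of item 27137 the a.e. leaf is the one a
strip-lift `… → FreeLocusLoss3` can consume.  Prop definitions = this leaf only.  No `sorry`; standard axioms; no instances,
no notation.
-/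

set_option linter.dupNamespace false

noncomputable section

open scoped Classical

namespace Summit.QuantumAdvantage.QuantumAdvantage.Theorems.LocusDial

open Finset
open Literature.Computability.QuantumComplexity Literature.Computability.QuantumComplexity.RingHLF
open Literature.Computability.MetaComplexity Literature.Computability.MetaComplexity.Smolensky
open Summit.QuantumAdvantage.AdviceFreeQNC0
open Summit.QuantumAdvantage.QuantumAdvantage.Theses (ExactnessDial.PolyLossOddU3)
open Summit.QuantumAdvantage.QuantumAdvantage.Theorems.HolonomyDial (gCond)
open Summit.QuantumAdvantage.QuantumAdvantage.Theorems.AnchorDial (outB dev mpStrat mpStrat_mem deg_bump4)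

variable {N : ℕ}

/-- **`FreePointerLossAE3`** — the free pointer with A.E.-UNIQUE declaration: a polylog-degree anchor family `A_k`
declaring exactly one position on all but `2^{n-1}/log₂ n` odd inputs hits a kernel position AT A UNIQUELY DECLARED
input on at most a `1 - n^{-C}` fraction of the odd class.  NECESSARY for `U` (`freePointerLossAE3_of_fewLocusLoss3`)
and it gives the everywhere-declared `FreePointerLoss3` (`freePointerLoss3_of_ae`). -/
def FreePointerLossAE3 : Prop :=
  ∃ C : ℕ, ∀ c : ℕ, ∃ n₀ : ℕ, ∀ n ≥ n₀, ∀ A : Fin n → CubeFn (ZMod 3) n,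
    (∀ k, A k ∈ lowDeg (ZMod 3) n ((Nat.log 2 n) ^ c)) →
    Nat.log 2 n * (univ.filter fun x : Fin n → Bool =>
        OddZeros x ∧ (univ.filter fun k : Fin n => A k x = 1).card ≠ 1).card ≤ 2 ^ (n - 1) →
      ((univ.filter fun x : Fin n → Bool => OddZeros x ∧ (univ.filter fun k : Fin n => A k x = 1).card = 1 ∧
          ∃ k : Fin n, A k x = 1 ∧ gCond x k.val).card : ℝ) ≤
        (1 - 1 / (n : ℝ) ^ C) * (2 : ℝ) ^ (n - 1)

/-- **NECESSITY `U → FreePointerLossAE3`**: the strategy `mpStrat A 1` has deviation set `{k(x)}` on every uniquely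
declared input, so it is few-locus at `(1, 0)` with exceptional set inside the non-uniquely-declared inputs, and it wins
at every uniquely declared input whose position is a kernel position. -/
theorem freePointerLossAE3_of_fewLocusLoss3 (h : FewLocusLoss3) : FreePointerLossAE3 := by
  obtain ⟨C, hC⟩ := h
  refine ⟨C, fun c => ?_⟩
  obtain ⟨n₀, hn₀⟩ := hC 1 0 (c + 1)
  refine ⟨max n₀ 64, fun n hn A hA hae => ?_⟩
  have hn64 : 64 ≤ n := le_of_max_le_right hn
  have hQ : ∀ i, mpStrat A (fun _ => 1) i ∈ lowDeg (ZMod 3) n ((Nat.log 2 n) ^ (c + 1)) := fun i =>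
    lowDeg_mono (deg_bump4 n c hn64) (mpStrat_mem hA (fun _ => one_mem_lowDeg _) i)
  have hfew : FewLocus 1 0 (mpStrat A (fun _ => 1)) := by
    unfold FewLocus
    have hsub : (univ.filter fun x : Fin n → Bool =>
        OddZeros x ∧ ¬ Coverable 1 0 (dev (mpStrat A (fun _ => 1)) x)) ⊆
        univ.filter fun x : Fin n → Bool => OddZeros x ∧ (univ.filter fun k : Fin n => A k x = 1).card ≠ 1 := by
      intro x hx
      rw [mem_filter] at hx ⊢
      refine ⟨mem_univ _, hx.2.1, fun h1 => hx.2.2 ?_⟩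
      obtain ⟨k₀, hk₀⟩ := card_eq_one.1 h1
      rw [dev_mpStrat_one (by omega) A x k₀ hk₀]
      exact coverable_singleton le_rfl 0 k₀
    exact le_trans (Nat.mul_le_mul_left _ (card_le_card hsub)) hae
  have hle := hn₀ n (le_of_max_le_left hn) _ hQ hfew
  refine le_trans ?_ hle
  have hsub : (univ.filter fun x : Fin n → Bool => OddZeros x ∧
        (univ.filter fun k : Fin n => A k x = 1).card = 1 ∧ ∃ k : Fin n, A k x = 1 ∧ gCond x k.val) ⊆
      univ.filter fun x : Fin n → Bool =>
        OddZeros x ∧ Rel x (fun i => decide (mpStrat A (fun _ => 1) i x = 1)) := by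
    intro x hx
    rw [mem_filter] at hx ⊢
    obtain ⟨-, hodd, h1, k, hk, hg⟩ := hx
    exact ⟨mem_univ _, hodd,
      (rel_mpStrat_one (by omega) A x hodd k (filter_eq_singleton_of_card h1 hk)).2 hg⟩
  exact_mod_cast card_le_card hsub

/-- the everywhere-declared law is the empty-exceptional-set case. -/
theorem freePointerLoss3_of_ae (h : FreePointerLossAE3) : FreePointerLoss3 := by
  obtain ⟨C, hC⟩ := h
  refine ⟨C, fun c => ?_⟩
  obtain ⟨n₀, hn₀⟩ := hC c
  refine ⟨n₀, fun n hn A hA huniq => ?_⟩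
  have h0 : (univ.filter fun x : Fin n → Bool =>
      OddZeros x ∧ (univ.filter fun k : Fin n => A k x = 1).card ≠ 1) = ∅ :=
    filter_eq_empty_iff.2 fun x _ hx => hx.2 (huniq x hx.1)
  have hae : Nat.log 2 n * (univ.filter fun x : Fin n → Bool =>
      OddZeros x ∧ (univ.filter fun k : Fin n => A k x = 1).card ≠ 1).card ≤ 2 ^ (n - 1) := by
    rw [h0, card_empty, mul_zero]; exact Nat.zero_le _
  have h := hn₀ n hn A hA hae
  have hset : (univ.filter fun x : Fin n → Bool => OddZeros x ∧ ∃ k : Fin n, A k x = 1 ∧ gCond x k.val) =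
      univ.filter fun x : Fin n → Bool => OddZeros x ∧
        (univ.filter fun k : Fin n => A k x = 1).card = 1 ∧ ∃ k : Fin n, A k x = 1 ∧ gCond x k.val := by
    apply filter_congr
    intro x _
    exact ⟨fun ⟨ho, hk⟩ => ⟨ho, huniq x ho, hk⟩, fun ⟨ho, _, hk⟩ => ⟨ho, hk⟩⟩
  rw [hset]
  exact h

/-- `T → FreePointerLossAE3`. -/
theorem freePointerLossAE3_of_polyLossOddU3 (h : ExactnessDial.PolyLossOddU3) : FreePointerLossAE3 :=
  freePointerLossAE3_of_fewLocusLoss3 (fewLocusLoss3_of_polyLossOddU3 h)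

end Summit.QuantumAdvantage.QuantumAdvantage.Theorems.LocusDial
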